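import Summits.AtomisticToContinuum.BoseEinsteinCondensation.Theses.BECClassicalWindow
import Summits.AtomisticToContinuum.BoseEinsteinCondensation.Theorems.BECCutLineWeakDisorderZeroModeOfLandscape

/-!
# Route `BECClassicalWindow` — the glue support `ThermalDescent` (stmt-AtomisticToContinuum-9075)

Closes stmt-AtomisticToContinuum-9075 (exact signature of
`Summit.AtomisticToContinuum.BoseEinsteinCondensation.Theses.BECClassicalWindow.ThermalDescent`):
the pure-bookkeeping glue

  `ThermalWindowZeroMode → ThermalMonotonicity → GroundStateRigidity →
   [ThermalGroundStateLimit, inlined] → [OccupationStability, inlined] → X_B1`,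

where X_B1 (zero-mode occupation `≥ c' N` for EVERY `δ`-near-minimiser of the Dirichlet energy,
for all large `N`, at every small density) is verbatim the hypothesis of the proved frame theorem
`AtomisticToContinuum.BECInfraredBound.bec_of_zeroMode` used by the route's deciding theorem.

Proof (the paragraph `## Assembly` of the route; Lieb–Seiringer–Solovej–Yngvason 2005 §1.2 for the
objects, the argument is elementary): fix `v`; `ThermalWindowZeroMode` gives `θ > 0`, a threshold
and, for small `ρ`, a constant `c > 0` with thermal constant-mode occupation `≥ c N` at
`T₁ = θ ρ^{2/3}`, eventually in `N`; `ρ₀ := min` of the three thresholds; answer with the constant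
`1/(4C)` where `C = 4/c` (i.e. `c/16`). For large `N = n + 1` (intersection of the three
eventual-in-`N` sets): `ThermalMonotonicity` transports the bound at `T₁` to every `0 < T ≤ T₁`
with constant `c N / 2`, which is the hypothesis of `ThermalGroundStateLimit` at
`(N, L = (N/ρ)^{1/3}, T₀ = T₁)`; hence at every energy slack some near-minimiser `Ψ` has
`occ(φ₀, Ψ) ≥ c N / 4`. With `δ` from `GroundStateRigidity` at `η = 1/(4C)`, any `δ`-near-minimiser
`Φ` is `√η`-close to such a `Ψ` (taken at slack `δ`) up to a phase, and `OccupationStability` (the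
constant mode `φ₀ = L^{-3/2}·1_{Λ_L}` is measurable and normalised for `L > 0`) together with the
`√`-bookkeeping lemma `zeroMode_sqrt_bookkeeping` give `occ(φ₀, Φ) ≥ N/(4C)`.
-/

noncomputable section

namespace Summit.AtomisticToContinuum.BoseEinsteinCondensation.Theorems

open MeasureTheory ENNReal Filter Literature.MathematicalPhysics.QuantumManyBody.BoseGas

/-- Settles `stmt-AtomisticToContinuum-9075` (exact signature): the glue
`ThermalWindowZeroMode → ThermalMonotonicity → GroundStateRigidity → ThermalGroundStateLimit →
OccupationStability → X_B1` of route `BECClassicalWindow`, with `ρ₀ = min` of the thresholds,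
`T₁ = θ ρ^{2/3}`, constants `c N → c N / 2 → c N / 4`, `C = 4/c`, `η = 1/(4C)`, answer `1/(4C) = c/16`
(Lieb–Seiringer–Solovej–Yngvason 2005 §1.2 for the objects; elementary bookkeeping). [folklore] -/
theorem thermalDescent_proof :
    Summit.AtomisticToContinuum.BoseEinsteinCondensation.Theses.BECClassicalWindow.ThermalDescent := by
  unfold Summit.AtomisticToContinuum.BoseEinsteinCondensation.Theses.BECClassicalWindow.ThermalDescent
    Summit.AtomisticToContinuum.BoseEinsteinCondensation.Theses.BECClassicalWindow.ThermalWindowZeroMode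
    Summit.AtomisticToContinuum.BoseEinsteinCondensation.Theses.BECClassicalWindow.ThermalMonotonicity
    Summit.AtomisticToContinuum.BoseEinsteinCondensation.Theses.BECClassicalWindow.GroundStateRigidity
  intro hTW hTM hRig hTG hOcc v hv
  obtain ⟨θ, hθ, ρ₁, hρ₁, H₁⟩ := hTW v hv
  obtain ⟨ρ₂, hρ₂, H₂⟩ := hTM v hv
  obtain ⟨ρ₃, hρ₃, H₃⟩ := hRig v hv
  refine ⟨min ρ₁ (min ρ₂ ρ₃), lt_min hρ₁ (lt_min hρ₂ hρ₃), fun ρ hρ hρlt => ?_⟩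
  obtain ⟨c, hc, hevW⟩ := H₁ ρ hρ (hρlt.trans_le (min_le_left _ _))
  have hevM := H₂ ρ hρ (hρlt.trans_le ((min_le_right _ _).trans (min_le_left _ _)))
  have hevR := H₃ ρ hρ (hρlt.trans_le ((min_le_right _ _).trans (min_le_right _ _)))
  obtain ⟨C, hC, hcC⟩ : ∃ C : ℝ, 0 < C ∧ c / 4 * C = 1 :=
    ⟨(c / 4)⁻¹, inv_pos.mpr (by positivity), mul_inv_cancel₀ (by positivity)⟩
  refine ⟨1 / (4 * C), by positivity, ?_⟩
  filter_upwards [hevW, hevM, hevR, Filter.eventually_gt_atTop 0] with N hWN hMN hRN hNpos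
  obtain ⟨n, rfl⟩ : ∃ n, N = n + 1 := ⟨N - 1, by omega⟩
  have hLpos : 0 < sideLength ρ (n + 1) := by
    unfold sideLength
    exact Real.rpow_pos_of_pos (div_pos (Nat.cast_pos.mpr (Nat.succ_pos n)) hρ) _
  have hT₁ : 0 < θ * ρ ^ (2 / 3 : ℝ) := mul_pos hθ (Real.rpow_pos_of_pos hρ _)
  have hcN : 0 < c * ((n + 1 : ℕ) : ℝ) := by positivity
  -- thermal bound `c N` at `T₁ = θ ρ^{2/3}` (ThermalWindowZeroMode), transported by
  -- ThermalMonotonicity to every `0 < T ≤ T₁` with constant `c N / 2`, then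
  -- ThermalGroundStateLimit: at every energy slack some near-minimiser has `occ(φ₀) ≥ c N / 4`
  have hGS := hTG v hv (n + 1) (sideLength ρ (n + 1)) (θ * ρ ^ (2 / 3 : ℝ))
    (c * ((n + 1 : ℕ) : ℝ) / 2) hLpos hT₁
    (fun T hT hTle => hMN (θ * ρ ^ (2 / 3 : ℝ)) T (c * ((n + 1 : ℕ) : ℝ)) hT hTle hWN
      (c * ((n + 1 : ℕ) : ℝ) / 2) (by linarith))
    (c / 4 * ((n + 1 : ℕ) : ℝ)) (by linarith)
  obtain ⟨δ, hδ, hrig⟩ := hRN (1 / (4 * C)) (by positivity)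
  refine ⟨δ, hδ, fun Φ hΦE => ?_⟩
  obtain ⟨Ψ, hΨE, hΨocc⟩ := hGS δ hδ
  obtain ⟨c₀, hc₀, hclose⟩ := hrig Ψ Φ hΨE hΦE
  have hstab := hOcc n (sideLength ρ (n + 1)) _
    (_root_.AtomisticToContinuum.BECInfraredBound.aestronglyMeasurable_constMode _)
    (_root_.AtomisticToContinuum.BECInfraredBound.lintegral_constMode_sq hLpos) Ψ Φ c₀ hc₀
  have hK0 : ENNReal.ofReal C ≠ 0 := (ENNReal.ofReal_pos.mpr hC).ne'
  have hE : ∫⁻ X, (‖Ψ.ψ X - c₀ * Φ.ψ X‖₊ : ℝ≥0∞) ^ 2 ≤ (4 * ENNReal.ofReal C)⁻¹ := by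
    refine hclose.trans (le_of_eq ?_)
    rw [one_div, ENNReal.ofReal_inv_of_pos (by positivity), ENNReal.ofReal_mul (by norm_num),
      ENNReal.ofReal_ofNat]
  have h1 : ((n + 1 : ℕ) : ℝ≥0∞)
      ≤ occupation (n + 1) ((box (sideLength ρ (n + 1))).indicator
          fun _ => ((Real.sqrt (sideLength ρ (n + 1) ^ 3))⁻¹ : ℂ)) Ψ.ψ * ENNReal.ofReal C :=
    calc ((n + 1 : ℕ) : ℝ≥0∞) = ENNReal.ofReal (c / 4 * ((n + 1 : ℕ) : ℝ)) * ENNReal.ofReal C := by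
          rw [← ENNReal.ofReal_mul (by positivity), mul_right_comm, hcC, one_mul,
            ENNReal.ofReal_natCast]
      _ ≤ _ := by gcongr
  have key := zeroMode_sqrt_bookkeeping hK0 (ENNReal.natCast_ne_top (n + 1)) h1 hstab hE
  calc ENNReal.ofReal (1 / (4 * C) * ((n + 1 : ℕ) : ℝ))
      = ((n + 1 : ℕ) : ℝ≥0∞) / (4 * ENNReal.ofReal C) := by
        rw [ENNReal.ofReal_mul (by positivity), ENNReal.ofReal_natCast, one_div,
          ENNReal.ofReal_inv_of_pos (by positivity), ENNReal.ofReal_mul (by norm_num),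
          ENNReal.ofReal_ofNat, ENNReal.div_eq_inv_mul]
    _ ≤ _ := key

end Summit.AtomisticToContinuum.BoseEinsteinCondensation.Theorems

end
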